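import Mathlib
import Summits.MatrixMultiplication.MatrixMultiplication.Theorems.FidelityWitnessesFidelityGapTwoSixExplicitKernel
import Literature.Computability.AlgebraicComplexity.BorderApolarityGeneric
import Literature.Computability.AlgebraicComplexity.BorderRankMatMulTwoCert

/-!
# `FidelityGapTwoSixExplicit` — the two inputs: slice defect from fidelity, the ten-plane from rank

Part of the proof of `FidelityWitnesses.FidelityGapTwoSixExplicit` (stmt-MatrixMultiplication-14041); see
`FidelityWitnessesFidelityGapTwoSixExplicitDefs.lean` for the line of argument.  Here: (1) the metric
transfer — if `S` has fidelity `> 1 − ε` with `T = ⟨2,2,2⟩` then every bilinear form annihilating the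
slices of `S` has slice defect `≤ 8ε` against `T` (project `T` onto the line through `S`,
Cauchy–Schwarz slice by slice); (2) `dim Alt ≥ 24` for the alternating `(210)`/`(120)` arrays; (3) the
`10`-plane of a rank-`≤ 6` tensor with `dim F·A* ≤ 34`, `dim F·B* ≤ 34`, from the tree's weak border
apolarity `TensorApolarity.exists_subspace_of_algBorderRank_le` (Conner–Harper–Landsberg 2023 §2.3).
-/

noncomputable section

namespace Summit.MatrixMultiplication.MatrixMultiplication.Theorems.GapTwoSixExplicit

-- single-conjunct summit: the `Summit.<S>.<P>` prefix repeats `MatrixMultiplication` by design (D-0017)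
set_option linter.dupNamespace false

open scoped BigOperators ComplexConjugate InnerProductSpace
open Literature.Computability.AlgebraicComplexity Module

/-! ## High fidelity forces a small slice defect -/

/-- Cauchy–Schwarz for a finite bilinear pairing of complex families:
`|Σ f p · g p|² ≤ (Σ |f p|²)(Σ |g p|²)`. [folklore] -/
theorem norm_sq_sum_mul_le {ι : Type} [Fintype ι] (f g : ι → ℂ) :
    ‖∑ p, f p * g p‖ ^ 2 ≤ (∑ p, ‖f p‖ ^ 2) * ∑ p, ‖g p‖ ^ 2 := by
  let x : EuclideanSpace ℂ ι := WithLp.toLp 2 fun p => conj (f p)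
  let y : EuclideanSpace ℂ ι := WithLp.toLp 2 g
  have hxy : ⟪x, y⟫_ℂ = ∑ p, f p * g p := by
    simp [x, y, PiLp.inner_apply, mul_comm]
  have hx : ‖x‖ ^ 2 = ∑ p, ‖f p‖ ^ 2 := by
    rw [EuclideanSpace.norm_sq_eq]; simp [x]
  have hy : ‖y‖ ^ 2 = ∑ p, ‖g p‖ ^ 2 := by
    rw [EuclideanSpace.norm_sq_eq]
  rw [← hxy, ← hx, ← hy, ← mul_pow]
  exact pow_le_pow_left₀ (norm_nonneg _) (norm_inner_le_norm x y) 2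

/-- **Annihilator defect under high fidelity** (the metric transfer).  If
`(1 − ε)·8·Σ|S|² < |Σ S·T|²` for `T = ⟨2,2,2⟩`, then every bilinear form `f` annihilating the
slices of `S` almost annihilates the slices of `T`:  `Σ_c |Σ_p f p T c p|² ≤ 8ε · Σ |f p|²`.
(Project `T` onto the line through `S`: `T = (ω̄/‖S‖²) S + T⊥` with `‖T⊥‖² = 8 − |ω|²/‖S‖² < 8ε`; the
pairing with `f` kills `S`; Cauchy–Schwarz slice by slice.) [folklore] -/
theorem defect_of_fidelity {ε : ℝ} {S : P2 → P2 → P2 → ℂ}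
    (hfid : (1 - ε) * 8 * (∑ a, ∑ b, ∑ c, ‖S a b c‖ ^ 2)
      < ‖∑ a, ∑ b, ∑ c, S a b c * matMulTensor ℂ 2 2 2 a b c‖ ^ 2)
    {f : P2 × P2 → ℂ} (hf : f ∈ TensorApolarity.slicePerp S) :
    (∑ c : P2, ‖∑ p : P2 × P2, f p * T2 c p.1 p.2‖ ^ 2) ≤ 8 * ε * ∑ p, ‖f p‖ ^ 2 := by
  -- the data in `(output, pair)` form
  set N : ℝ := ∑ a : P2, ∑ p : P2 × P2, ‖S a p.1 p.2‖ ^ 2 with hN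
  set ω : ℂ := ∑ a : P2, ∑ p : P2 × P2, S a p.1 p.2 * T2 a p.1 p.2 with hω
  have hN' : (∑ a, ∑ b, ∑ c, ‖S a b c‖ ^ 2) = N := by
    rw [hN]; refine Finset.sum_congr rfl fun a _ => ?_
    exact (Fintype.sum_prod_type' (fun b c => ‖S a b c‖ ^ 2)).symm
  have hω' : (∑ a, ∑ b, ∑ c, S a b c * matMulTensor ℂ 2 2 2 a b c) = ω := by
    rw [hω]; refine Finset.sum_congr rfl fun a _ => ?_
    exact (Fintype.sum_prod_type' (fun b c => S a b c * matMulTensor ℂ 2 2 2 a b c)).symm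
  rw [hN', hω'] at hfid
  -- `S ≠ 0`, `N > 0`
  have hNnn : 0 ≤ N := by rw [hN]; positivity
  have hNpos : 0 < N := by
    rcases hNnn.eq_or_lt with h | h
    · exfalso
      have hS0 : ∀ a (p : P2 × P2), S a p.1 p.2 = 0 := by
        intro a p
        have h1 : (∑ a : P2, ∑ p : P2 × P2, ‖S a p.1 p.2‖ ^ 2) = 0 := by rw [← hN]; exact h.symm
        have h2 := (Finset.sum_eq_zero_iff_of_nonneg (fun a _ => by positivity)).1 h1 a
          (Finset.mem_univ _)
        have h3 := (Finset.sum_eq_zero_iff_of_nonneg (fun p _ => by positivity)).1 h2 p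
          (Finset.mem_univ _)
        simpa using h3
      have hω0 : ω = 0 := by
        rw [hω]; exact Finset.sum_eq_zero fun a _ => Finset.sum_eq_zero fun p _ => by
          rw [hS0 a p, zero_mul]
      rw [hω0, ← h] at hfid
      simp at hfid
    · exact h
  -- the residual `T⊥ = T − α S`, `α = conj ω / N`
  set α : ℂ := conj ω / (N : ℂ) with hα
  have hNC : (N : ℂ) ≠ 0 := by exact_mod_cast hNpos.ne'
  -- `‖T‖² = 8`
  have hT8 : (∑ a : P2, ∑ p : P2 × P2, ‖T2 a p.1 p.2‖ ^ 2) = 8 := by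
    simp only [T2_apply, Fintype.sum_prod_type, Fin.sum_univ_two]
    norm_num
  -- `T` is real: `conj T = T`
  have hTreal : ∀ a (p : P2 × P2), conj (T2 a p.1 p.2) = T2 a p.1 p.2 := fun a p => by
    rw [T2_apply]; split_ifs <;> simp
  -- `‖T⊥‖² = 8 − |ω|²/N`
  have hres : (∑ a : P2, ∑ p : P2 × P2, ‖T2 a p.1 p.2 - α * S a p.1 p.2‖ ^ 2) = 8 - ‖ω‖ ^ 2 / N := by
    -- complex identity, then real parts
    have hC : (∑ a : P2, ∑ p : P2 × P2, conj (T2 a p.1 p.2 - α * S a p.1 p.2)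
        * (T2 a p.1 p.2 - α * S a p.1 p.2))
        = (∑ a : P2, ∑ p : P2 × P2, conj (T2 a p.1 p.2) * T2 a p.1 p.2)
          - α * ω - conj α * conj ω
          + α * conj α * (∑ a : P2, ∑ p : P2 × P2, conj (S a p.1 p.2) * S a p.1 p.2) := by
      have e1 : α * ω = ∑ a : P2, ∑ p : P2 × P2, α * (S a p.1 p.2 * T2 a p.1 p.2) := by
        rw [hω, Finset.mul_sum]; simp_rw [Finset.mul_sum]
      have e2 : conj α * conj ω = ∑ a : P2, ∑ p : P2 × P2,
          conj α * (conj (S a p.1 p.2) * T2 a p.1 p.2) := by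
        rw [hω, map_sum, Finset.mul_sum]
        refine Finset.sum_congr rfl fun a _ => ?_
        rw [map_sum, Finset.mul_sum]
        refine Finset.sum_congr rfl fun p _ => ?_
        rw [map_mul, hTreal]
      have e3 : α * conj α * (∑ a : P2, ∑ p : P2 × P2, conj (S a p.1 p.2) * S a p.1 p.2)
          = ∑ a : P2, ∑ p : P2 × P2, α * conj α * (conj (S a p.1 p.2) * S a p.1 p.2) := by
        rw [Finset.mul_sum]; simp_rw [Finset.mul_sum]
      rw [e1, e2, e3]
      simp only [← Finset.sum_sub_distrib, ← Finset.sum_add_distrib]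
      refine Finset.sum_congr rfl fun a _ => Finset.sum_congr rfl fun p _ => ?_
      rw [map_sub, map_mul, hTreal]
      ring
    have hSS : (∑ a : P2, ∑ p : P2 × P2, conj (S a p.1 p.2) * S a p.1 p.2) = (N : ℂ) := by
      rw [hN]; push_cast
      refine Finset.sum_congr rfl fun a _ => Finset.sum_congr rfl fun p _ => ?_
      rw [Complex.conj_mul']
    have hTT : (∑ a : P2, ∑ p : P2 × P2, conj (T2 a p.1 p.2) * T2 a p.1 p.2) = (8 : ℂ) := by
      have h8 : ((8 : ℝ) : ℂ) = 8 := by norm_num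
      rw [← h8, ← hT8]; push_cast
      refine Finset.sum_congr rfl fun a _ => Finset.sum_congr rfl fun p _ => ?_
      rw [Complex.conj_mul']
    rw [hSS, hTT] at hC
    have hconjα : conj α = ω / (N : ℂ) := by
      rw [hα, map_div₀, Complex.conj_conj, Complex.conj_ofReal]
    have hωω : conj ω * ω = ((‖ω‖ ^ 2 : ℝ) : ℂ) := by
      rw [Complex.conj_mul']; push_cast; ring
    have hαω : α * ω + conj α * conj ω - α * conj α * (N : ℂ) = ((‖ω‖ ^ 2 / N : ℝ) : ℂ) := by
      have e : α * ω + conj α * conj ω - α * conj α * (N : ℂ) = conj ω * ω / (N : ℂ) := by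
        rw [hconjα, hα]
        field_simp
        ring
      rw [e, hωω]
      push_cast
      ring
    have hC' : (∑ a : P2, ∑ p : P2 × P2, conj (T2 a p.1 p.2 - α * S a p.1 p.2)
        * (T2 a p.1 p.2 - α * S a p.1 p.2)) = ((8 - ‖ω‖ ^ 2 / N : ℝ) : ℂ) := by
      rw [hC, show ((8 - ‖ω‖ ^ 2 / N : ℝ) : ℂ) = 8 - ((‖ω‖ ^ 2 / N : ℝ) : ℂ) by push_cast; ring,
        ← hαω]
      ring
    simp only [Complex.conj_mul'] at hC'
    exact_mod_cast hC'
  have hres8 : 8 - ‖ω‖ ^ 2 / N < 8 * ε := by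
    have h1 : (1 - ε) * 8 * N < ‖ω‖ ^ 2 := hfid
    have h2 : (1 - ε) * 8 < ‖ω‖ ^ 2 / N := by rw [lt_div_iff₀ hNpos]; exact h1
    linarith
  -- pairing with `f` kills `S`
  have hpair : ∀ c : P2, (∑ p : P2 × P2, f p * T2 c p.1 p.2)
      = ∑ p : P2 × P2, f p * (T2 c p.1 p.2 - α * S c p.1 p.2) := by
    intro c
    have h0 : (∑ p : P2 × P2, f p * S c p.1 p.2) = 0 := hf c
    have : (∑ p : P2 × P2, f p * (T2 c p.1 p.2 - α * S c p.1 p.2))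
        = (∑ p : P2 × P2, f p * T2 c p.1 p.2) - α * ∑ p : P2 × P2, f p * S c p.1 p.2 := by
      rw [Finset.mul_sum, ← Finset.sum_sub_distrib]
      refine Finset.sum_congr rfl fun p _ => ?_; ring
    rw [this, h0, mul_zero, sub_zero]
  -- Cauchy–Schwarz slice by slice
  calc (∑ c : P2, ‖∑ p : P2 × P2, f p * T2 c p.1 p.2‖ ^ 2)
      = ∑ c : P2, ‖∑ p : P2 × P2, f p * (T2 c p.1 p.2 - α * S c p.1 p.2)‖ ^ 2 := by
        simp only [hpair]
    _ ≤ ∑ c : P2, (∑ p : P2 × P2, ‖f p‖ ^ 2) * ∑ p : P2 × P2, ‖T2 c p.1 p.2 - α * S c p.1 p.2‖ ^ 2 :=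
        Finset.sum_le_sum fun c _ => norm_sq_sum_mul_le _ _
    _ = (∑ p : P2 × P2, ‖f p‖ ^ 2) * (8 - ‖ω‖ ^ 2 / N) := by rw [← Finset.mul_sum, hres]
    _ ≤ 8 * ε * ∑ p, ‖f p‖ ^ 2 := by
        rw [mul_comm]
        exact mul_le_mul_of_nonneg_right hres8.le (Finset.sum_nonneg fun p _ => by positivity)


/-! ## Dimension of the alternating arrays: `dim Alt ≥ 24` -/

/-- The strictly upper-triangular index pairs of `P2 × P2` number `6`. [folklore] -/
theorem card_ltPairs :
    Fintype.card {t : P2 × P2 // MatMulTwo.encP t.1 < MatMulTwo.encP t.2} = 6 := by rfl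

/-- `dim altA ≥ 24`: the `24` elementary alternating arrays `e_{(k,(k',m))} − e_{(k',(k,m))}`, `k < k'`,
are linearly independent. [folklore] -/
theorem finrank_altA_ge : 24 ≤ finrank ℂ (TensorApolarity.altA ℂ P2 P2) := by
  classical
  let I : Type := {t : P2 × P2 // MatMulTwo.encP t.1 < MatMulTwo.encP t.2} × P2
  -- the elementary alternating arrays
  let a : I → (P2 × (P2 × P2) → ℂ) := fun i =>
    Pi.single (i.1.1.1, (i.1.1.2, i.2)) 1 - Pi.single (i.1.1.2, (i.1.1.1, i.2)) 1
  have hne : ∀ i : I, i.1.1.1 ≠ i.1.1.2 := by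
    intro i h
    have := i.1.2
    rw [h] at this
    exact lt_irrefl _ this
  have hmem : ∀ i : I, a i ∈ TensorApolarity.altA ℂ P2 P2 := by
    intro i
    refine ⟨fun k k' m => ?_, fun k m => ?_⟩
    · simp only [a, Pi.sub_apply, Pi.single_apply, Prod.mk.injEq]
      by_cases h1 : k = i.1.1.1 <;> by_cases h2 : k' = i.1.1.2 <;> by_cases h3 : m = i.2 <;>
        by_cases h4 : k = i.1.1.2 <;> by_cases h5 : k' = i.1.1.1 <;>
        simp [h1, h2, h3, h4, h5, hne i, (hne i).symm]
    · simp only [a, Pi.sub_apply, Pi.single_apply, Prod.mk.injEq]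
      by_cases h1 : k = i.1.1.1 <;> by_cases h4 : k = i.1.1.2 <;> by_cases h3 : m = i.2 <;>
        simp [h1, h4, h3, hne i, (hne i).symm]
  -- restriction to the upper-triangular coordinates sends `a i` to the standard basis
  let R : (P2 × (P2 × P2) → ℂ) →ₗ[ℂ] (I → ℂ) :=
    { toFun := fun g i => g (i.1.1.1, (i.1.1.2, i.2))
      map_add' := fun _ _ => rfl
      map_smul' := fun _ _ => rfl }
  have hR : ∀ i : I, R (a i) = Pi.single i 1 := by
    intro i
    funext j
    simp only [R, LinearMap.coe_mk, AddHom.coe_mk, a, Pi.sub_apply, Pi.single_apply, Prod.mk.injEq]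
    by_cases hij : j = i
    · subst hij
      simp [hne j, (hne j).symm]
    · have h1 : ¬ (j.1.1.1 = i.1.1.1 ∧ j.1.1.2 = i.1.1.2 ∧ j.2 = i.2) := by
        rintro ⟨e1, e2, e3⟩
        apply hij
        ext <;> simp_all [Prod.ext_iff]
      have h2 : ¬ (j.1.1.1 = i.1.1.2 ∧ j.1.1.2 = i.1.1.1 ∧ j.2 = i.2) := by
        rintro ⟨e1, e2, -⟩
        have hi := i.1.2
        have hj := j.1.2
        rw [e1, e2] at hj
        exact lt_asymm hi hj
      simp [h1, h2, hij]
  have hli : LinearIndependent ℂ a := by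
    apply LinearIndependent.of_comp R
    have : R ∘ a = fun i => Pi.single i (1 : ℂ) := funext hR
    rw [this]
    exact Pi.linearIndependent_single_one I ℂ
  -- as a family in `altA`
  let a' : I → TensorApolarity.altA ℂ P2 P2 := fun i => ⟨a i, hmem i⟩
  have hli' : LinearIndependent ℂ a' :=
    LinearIndependent.of_comp (TensorApolarity.altA ℂ P2 P2).subtype (by exact hli)
  have h := hli'.fintype_card_le_finrank
  have hcard : Fintype.card I = 24 := by
    simp only [I, Fintype.card_prod, card_ltPairs, Fintype.card_fin]
  omega


/-- `dim altB ≥ 24`, likewise. [folklore] -/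
theorem finrank_altB_ge : 24 ≤ finrank ℂ (TensorApolarity.altB ℂ P2 P2) := by
  classical
  let I : Type := P2 × {t : P2 × P2 // MatMulTwo.encP t.1 < MatMulTwo.encP t.2}
  let a : I → (P2 × (P2 × P2) → ℂ) := fun i =>
    Pi.single (i.1, (i.2.1.1, i.2.1.2)) 1 - Pi.single (i.1, (i.2.1.2, i.2.1.1)) 1
  have hne : ∀ i : I, i.2.1.1 ≠ i.2.1.2 := by
    intro i h
    have := i.2.2
    rw [h] at this
    exact lt_irrefl _ this
  have hmem : ∀ i : I, a i ∈ TensorApolarity.altB ℂ P2 P2 := by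
    intro i
    refine ⟨fun k m m' => ?_, fun k m => ?_⟩
    · simp only [a, Pi.sub_apply, Pi.single_apply, Prod.mk.injEq]
      by_cases h1 : k = i.1 <;> by_cases h2 : m = i.2.1.1 <;> by_cases h3 : m' = i.2.1.2 <;>
        by_cases h4 : m = i.2.1.2 <;> by_cases h5 : m' = i.2.1.1 <;>
        simp [h1, h2, h3, h4, h5, hne i, (hne i).symm]
    · simp only [a, Pi.sub_apply, Pi.single_apply, Prod.mk.injEq]
      by_cases h1 : k = i.1 <;> by_cases h2 : m = i.2.1.1 <;> by_cases h4 : m = i.2.1.2 <;>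
        simp [h1, h2, h4, hne i, (hne i).symm]
  let R : (P2 × (P2 × P2) → ℂ) →ₗ[ℂ] (I → ℂ) :=
    { toFun := fun g i => g (i.1, (i.2.1.1, i.2.1.2))
      map_add' := fun _ _ => rfl
      map_smul' := fun _ _ => rfl }
  have hR : ∀ i : I, R (a i) = Pi.single i 1 := by
    intro i
    funext j
    simp only [R, LinearMap.coe_mk, AddHom.coe_mk, a, Pi.sub_apply, Pi.single_apply, Prod.mk.injEq]
    by_cases hij : j = i
    · subst hij
      simp [hne j, (hne j).symm]
    · have h1 : ¬ (j.1 = i.1 ∧ j.2.1.1 = i.2.1.1 ∧ j.2.1.2 = i.2.1.2) := by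
        rintro ⟨e1, e2, e3⟩
        apply hij
        ext <;> simp_all [Prod.ext_iff]
      have h2 : ¬ (j.1 = i.1 ∧ j.2.1.1 = i.2.1.2 ∧ j.2.1.2 = i.2.1.1) := by
        rintro ⟨-, e1, e2⟩
        have hi := i.2.2
        have hj := j.2.2
        rw [e1, e2] at hj
        exact lt_asymm hi hj
      simp [h1, h2, hij]
  have hli : LinearIndependent ℂ a := by
    apply LinearIndependent.of_comp R
    have : R ∘ a = fun i => Pi.single i (1 : ℂ) := funext hR
    rw [this]
    exact Pi.linearIndependent_single_one I ℂ
  let a' : I → TensorApolarity.altB ℂ P2 P2 := fun i => ⟨a i, hmem i⟩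
  have hli' : LinearIndependent ℂ a' :=
    LinearIndependent.of_comp (TensorApolarity.altB ℂ P2 P2).subtype (by exact hli)
  have h := hli'.fintype_card_le_finrank
  have hcard : Fintype.card I = 24 := by
    simp only [I, Fintype.card_prod, card_ltPairs, Fintype.card_fin]
  omega

/-! ## The `10`-plane of a rank-`≤ 6` tensor (weak border apolarity, tree theorem) -/

/-- A `d`-dimensional subspace inside a subspace of dimension `≥ d`. [folklore] -/
theorem exists_le_finrank_eq {V : Type*} [AddCommGroup V] [Module ℂ V] (F₀ : Submodule ℂ V)
    [FiniteDimensional ℂ F₀] {d : ℕ} (hd : d ≤ finrank ℂ F₀) :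
    ∃ F : Submodule ℂ V, F ≤ F₀ ∧ finrank ℂ F = d := by
  let bF := Module.finBasis ℂ F₀
  let v : Fin d → V := fun i => (bF (Fin.castLE hd i) : V)
  have hv : LinearIndependent ℂ v := by
    have h1 : LinearIndependent ℂ (fun i : Fin d => bF (Fin.castLE hd i)) :=
      bF.linearIndependent.comp _ (Fin.castLE_injective hd)
    exact h1.map' F₀.subtype (Submodule.ker_subtype F₀)
  refine ⟨Submodule.span ℂ (Set.range v), ?_, ?_⟩
  · rw [Submodule.span_le]
    rintro _ ⟨i, rfl⟩
    exact (bF (Fin.castLE hd i)).2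
  · rw [finrank_span_eq_card hv, Fintype.card_fin]

/-- **The `10`-plane of a rank-`≤ 6` tensor.**  A tensor `S` of rank `≤ 6` in the `2 × 2` format has
a `10`-dimensional space `F` of bilinear forms annihilating its slices with `dim F·A* ≤ 34` and
`dim F·B* ≤ 34` — weak border apolarity in bi-degrees `(110)`, `(210)`, `(120)` for the HONEST rank,
from the tree theorem `TensorApolarity.exists_subspace_of_algBorderRank_le` (which perturbs a possibly
degenerate decomposition into general position). [cite: ConnerHarperLandsberg2023, §2.3 (i)–(iii)] -/
theorem exists_tenPlane {S : P2 → P2 → P2 → ℂ} (hS : tensorRank S ≤ 6) :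
    ∃ F : Submodule ℂ (P2 × P2 → ℂ), F ≤ TensorApolarity.slicePerp S ∧ finrank ℂ F = 10 ∧
      finrank ℂ (TensorApolarity.prodA F) ≤ 34 ∧ finrank ℂ (TensorApolarity.prodB F) ≤ 34 := by
  classical
  have hbr : algBorderRank S ≤ 6 := (algBorderRank_le_tensorRank S).trans hS
  have h616 : 6 ≤ Fintype.card (P2 × P2) := by simp
  let e : Fin 6 ↪ P2 × P2 := (Fin.castLEEmb h616).trans (Fintype.equivFin (P2 × P2)).symm.toEmbedding
  obtain ⟨F₀, hF₀S, hdim, hA₀, hB₀⟩ := TensorApolarity.exists_subspace_of_algBorderRank_le S hbr e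
  have hcard : Fintype.card P2 = 4 := by simp
  rw [hcard] at hdim hA₀ hB₀
  norm_num at hdim hA₀ hB₀
  haveI : FiniteDimensional ℂ F₀ := inferInstance
  obtain ⟨F, hFF₀, hF10⟩ := exists_le_finrank_eq F₀ hdim
  refine ⟨F, hFF₀.trans hF₀S, hF10, ?_, ?_⟩
  · have hmono : TensorApolarity.prodA F ⊔ TensorApolarity.altA ℂ P2 P2
        ≤ TensorApolarity.prodA F₀ ⊔ TensorApolarity.altA ℂ P2 P2 :=
      sup_le_sup_right (TensorApolarity.prodA_mono hFF₀) _
    have h1 := (Submodule.finrank_mono hmono).trans hA₀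
    have h2 := Submodule.finrank_sup_add_finrank_inf_eq (TensorApolarity.prodA F)
      (TensorApolarity.altA ℂ P2 P2)
    rw [TensorApolarity.prodA_inf_altA_eq_bot, finrank_bot, add_zero] at h2
    have h3 := finrank_altA_ge
    omega
  · have hmono : TensorApolarity.prodB F ⊔ TensorApolarity.altB ℂ P2 P2
        ≤ TensorApolarity.prodB F₀ ⊔ TensorApolarity.altB ℂ P2 P2 :=
      sup_le_sup_right (TensorApolarity.prodB_mono hFF₀) _
    have h1 := (Submodule.finrank_mono hmono).trans hB₀
    have h2 := Submodule.finrank_sup_add_finrank_inf_eq (TensorApolarity.prodB F)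
      (TensorApolarity.altB ℂ P2 P2)
    rw [TensorApolarity.prodB_inf_altB_eq_bot, finrank_bot, add_zero] at h2
    have h3 := finrank_altB_ge
    omega

end Summit.MatrixMultiplication.MatrixMultiplication.Theorems.GapTwoSixExplicit

end
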